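import Literature.NumberTheory.EllipticCurves.Gamma0AwayCharacterExtensionProofs
import HarnessLib

/-!
# Serre's amalgam for `Γ₀(L′; ℤ[1/t])` in Hom-form: a COMPATIBLE PAIR of characters extends (`t` prime, `t ∤ L′`)

Topic `Literature/NumberTheory/EllipticCurves`; theorems only; sibling of `Gamma0AwayCharacterExtensionProofs.lean`,
whose theorem `gamma0Away_character_extension_of_shiftInvariant_holds` is the SYMMETRIC case (one character `u` of
`Γ₀(L′)` into a field, `t`-shift-invariant on `Γ₀(L′t)`).  Here: the full universal property of the amalgam
`Δ_t(L′) = Γ₀(L′; ℤ[1/t]) = Γ₀(L′) *_{Γ₀(L′t)} θ(Γ₀(L′))` (`θ = Ad(diag(t,1)⁻¹)`, Serre, *Trees*, II.1.4 Thm. 3 with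
I.4.1 Thm. 6; Brown, *Cohomology of Groups*, II.7 (7.1)) for maps to an ARBITRARY abelian group `K`: two additive
maps `φ₁, φ₂ : Γ₀(L′) → K` that are COMPATIBLE along the two embeddings of `Γ₀(L′t)` —
`φ₁(γ) = φ₂(diag(t,1) γ diag(t,1)⁻¹)` for `γ ∈ Γ₀(L′t)` — are the restrictions along `ι` and `θ ∘ ι` of one map
`Φ : SL₂(ℤ[1/t]) → K` additive on `Δ_t(L′)` (`exists_extension_of_compatible_pair`).  The proof is the sibling's,
verbatim, with the pair `(u, u)` replaced by `(φ₁, φ₂)`: the abstract lemma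
`Literature.GroupTheory.CombinatorialGroupTheory.Amalgam.exists_extension_of_pingPong` already takes an arbitrary
compatible family `f : ∀ b, G b →* M`.  The cell bsd-f2-manin's E-es-107 (`ThreeShiftAmalgamExtensionAll`, the case
`t = 3`, `Summits/…/Theorems/ManinLocalTwoThreeThreeShiftAmalgam.lean`) is the instance `t = 3`; the instance `t = 2`
is the input a 2-adic twin of that cell's nine-shift equaliser chain would consume.  Nothing about elliptic curves,
BSD or the Manin constant is used or proved here.

## References
* J.-P. Serre, *Trees*, Springer (1980), Ch. I §4.1 Thm. 6; Ch. II §1.4 Thm. 3 and Cor. 1. [SerreTrees1980]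
* K. S. Brown, *Cohomology of Groups*, GTM 87 (1982), Ch. II §7 (7.1). [Brown1982CohomologyGroups]
-/

noncomputable section

namespace Literature.NumberTheory.EllipticCurves

open scoped MatrixGroups
open CongruenceSubgroup Monoid Literature.NumberTheory.EllipticCurves.ModularForms
  Literature.GroupTheory.CombinatorialGroupTheory

namespace Gamma0Away

/-- **Serre's amalgam for `Γ₀(L′; ℤ[1/t])`, Hom-form for a compatible PAIR** (`t` prime, `t ∤ L′`, `K` any abelian
group): additive `φ₁, φ₂ : Γ₀(L′) → K` with `φ₁(γ) = φ₂(diag(t,1) γ diag(t,1)⁻¹)` for all `γ ∈ Γ₀(L′t)` are the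
restrictions along `ι` and `θ ∘ ι` (`θ = Gamma0Away.theta t = Ad(diag(t,1)⁻¹)`) of a map `Φ : SL₂(ℤ[1/t]) → K` which is
additive on `Δ_t(L′) = {g : g₁₀ ∈ L′·ℤ[1/t]}` — the universal property of
`Δ_t(L′) = Γ₀(L′) *_{Γ₀(L′t)} θΓ₀(L′)` for abelian targets (ping-pong `Gamma0AwayPingPong` + generation
`mem_of_apply_one_zero` + `Amalgam.exists_extension_of_pingPong`).
[cite: SerreTrees1980, Ch. I §4.1 Thm. 6, Ch. II §1.4 Thm. 3] [cite: Brown1982CohomologyGroups, Ch. II §7 (7.1)] -/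
theorem exists_extension_of_compatible_pair (t : ℕ) (ht : t.Prime) (L' : ℕ) (htL : ¬ t ∣ L')
    (K : Type*) [AddCommGroup K] (φ₁ φ₂ : Gamma0 L' → K)
    (h₁ : ∀ γ δ : Gamma0 L', φ₁ (γ * δ) = φ₁ γ + φ₁ δ) (h₂ : ∀ γ δ : Gamma0 L', φ₂ (γ * δ) = φ₂ γ + φ₂ δ)
    (hcompat : haveI : NeZero t := ⟨ht.ne_zero⟩
      ∀ γ : Gamma0 (L' * t),
        φ₁ (Gamma0.degeneracyConj L' (L' * t) 1 (mul_dvd_mul_left L' (one_dvd t)) γ) =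
          φ₂ (Gamma0.degeneracyConj L' (L' * t) t dvd_rfl γ)) :
    ∃ Φ : SL(2, Localization.Away (t : ℤ)) → K,
      (∀ g : SL(2, Localization.Away (t : ℤ)),
          (∃ s : Localization.Away (t : ℤ), g 1 0 = (L' : Localization.Away (t : ℤ)) * s) →
        ∀ g' : SL(2, Localization.Away (t : ℤ)),
          (∃ s : Localization.Away (t : ℤ), g' 1 0 = (L' : Localization.Away (t : ℤ)) * s) →
          Φ (g * g') = Φ g + Φ g') ∧
      (∀ γ : Gamma0 L',
        Φ (Matrix.SpecialLinearGroup.map (Int.castRingHom (Localization.Away (t : ℤ))) (γ : SL(2, ℤ))) = φ₁ γ) ∧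
      (∀ γ : Gamma0 L',
        Φ (theta t (Matrix.SpecialLinearGroup.map (Int.castRingHom (Localization.Away (t : ℤ))) (γ : SL(2, ℤ))))
          = φ₂ γ) := by
  haveI : Fact t.Prime := ⟨ht⟩
  haveI : NeZero t := ⟨ht.ne_zero⟩
  -- the amalgam data (verbatim from the sibling)
  let φ : ∀ _ : Bool, Gamma0 (L' * t) →* Gamma0 L' := fun b =>
    cond b (Gamma0.degeneracyConj L' (L' * t) t dvd_rfl)
      (Gamma0.degeneracyConj L' (L' * t) 1 (mul_dvd_mul_left L' (one_dvd t)))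
  have hφ : ∀ b, Function.Injective (φ b) := amalgamMaps_injective t L'
  let ιΓ : Gamma0 L' →* SL(2, Localization.Away (t : ℤ)) :=
    (Matrix.SpecialLinearGroup.map (Int.castRingHom (Localization.Away (t : ℤ)))).comp (Gamma0 L').subtype
  let ιΓ' : Gamma0 (L' * t) →* SL(2, Localization.Away (t : ℤ)) :=
    (Matrix.SpecialLinearGroup.map (Int.castRingHom (Localization.Away (t : ℤ)))).comp
      (Gamma0 (L' * t)).subtype
  let f : ∀ _ : Bool, Gamma0 L' →* SL(2, Localization.Away (t : ℤ)) := fun b =>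
    cond b ((theta t).comp ιΓ) ιΓ
  have hf : ∀ b, (f b).comp (φ b) = ιΓ' := by
    intro b
    cases b
    · ext γ : 1
      show Matrix.SpecialLinearGroup.map (Int.castRingHom (Localization.Away (t : ℤ)))
          ((Gamma0.degeneracyConj L' (L' * t) 1 (mul_dvd_mul_left L' (one_dvd t)) γ : Gamma0 L') : SL(2, ℤ))
        = Matrix.SpecialLinearGroup.map (Int.castRingHom (Localization.Away (t : ℤ))) (γ : SL(2, ℤ))
      rw [Gamma0.coe_degeneracyConj_one]
    · ext γ : 1
      exact theta_map_degeneracyConj t L' γ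
  let ψ : PushoutI φ →* SL(2, Localization.Away (t : ℤ)) := PushoutI.lift f ιΓ' hf
  have hψ_false : ∀ γ : Gamma0 L', ψ (PushoutI.of (φ := φ) false γ) =
      Matrix.SpecialLinearGroup.map (Int.castRingHom (Localization.Away (t : ℤ))) (γ : SL(2, ℤ)) :=
    fun γ => by simp [ψ, f, ιΓ]
  have hψ_true : ∀ γ : Gamma0 L', ψ (PushoutI.of (φ := φ) true γ) =
      theta t (Matrix.SpecialLinearGroup.map (Int.castRingHom (Localization.Away (t : ℤ))) (γ : SL(2, ℤ))) :=
    fun γ => by simp [ψ, f, ιΓ]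
  have hψ_base : ∀ c : Gamma0 (L' * t), ψ (PushoutI.base φ c) =
      Matrix.SpecialLinearGroup.map (Int.castRingHom (Localization.Away (t : ℤ))) (c : SL(2, ℤ)) :=
    fun c => by simp [ψ, ιΓ']
  -- the characters (this is the only change w.r.t. the sibling: an asymmetric pair)
  let f₁ : Gamma0 L' →* Multiplicative K :=
    MonoidHom.mk' (fun γ => Multiplicative.ofAdd (φ₁ γ)) fun γ δ => by simp only [h₁ γ δ, ofAdd_add]
  let f₂ : Gamma0 L' →* Multiplicative K :=
    MonoidHom.mk' (fun γ => Multiplicative.ofAdd (φ₂ γ)) fun γ δ => by simp only [h₂ γ δ, ofAdd_add]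
  have hf₁ : ∀ γ, f₁ γ = Multiplicative.ofAdd (φ₁ γ) := fun γ => rfl
  have hf₂ : ∀ γ, f₂ γ = Multiplicative.ofAdd (φ₂ γ) := fun γ => rfl
  let f' : ∀ b : Bool, Gamma0 L' →* Multiplicative K := fun b => cond b f₂ f₁
  have hf' : ∀ b, (f' b).comp (φ b) = f₁.comp (φ false) := by
    intro b
    cases b
    · rfl
    · ext γ : 1
      simp only [MonoidHom.comp_apply, f', φ, cond_true, cond_false, hf₁, hf₂, hcompat γ]
  -- the ping-pong hypotheses (verbatim from the sibling)
  obtain ⟨Φ, hmul, hof, -⟩ := Amalgam.exists_extension_of_pingPong hφ ψ {g | TopHeavy t g} (height t)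
    (fun γ => by
      rw [hψ_false]
      exact ⟨not_topHeavy_map t _, by rw [height_map, height_one]⟩)
    (fun γ hγ x hx => by
      rw [hψ_false]
      refine not_topHeavy_map_mul t _ (fun hd => hγ ?_) hx
      exact mem_range_inclusion_of_dvd t L' htL γ hd)
    (fun γ hγ x hx => by
      rw [hψ_true]
      refine topHeavy_theta_map_mul t _ (fun hd => hγ ?_) hx
      exact mem_range_degeneracyConj_of_dvd t L' γ hd)
    (fun c x => by
      rw [hψ_base]
      refine topHeavy_map_mul_iff t _ ?_ x
      have hc := c.2
      rw [Gamma0_mem] at hc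
      exact dvd_trans (by push_cast; exact dvd_mul_left _ _) ((ZMod.intCast_zmod_eq_zero_iff_dvd _ _).mp hc))
    (fun γ hγ => by
      rw [hψ_false] at hγ
      have := map_injective t (hγ.trans (map_one _).symm)
      exact Subtype.ext this)
    f' (f₁.comp (φ false)) hf'
  -- generation: `Γ₀(L′; ℤ[1/t]) ⊆ ψ(P)`
  have hS : ∀ γ : SL(2, ℤ), γ ∈ Gamma0 L' →
      Matrix.SpecialLinearGroup.map (Int.castRingHom (Localization.Away (t : ℤ))) γ ∈ ψ.range :=
    fun γ hγ => ⟨PushoutI.of (φ := φ) false ⟨γ, hγ⟩, hψ_false ⟨γ, hγ⟩⟩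
  have hS' : ∀ γ : SL(2, ℤ), γ ∈ Gamma0 L' →
      theta t (Matrix.SpecialLinearGroup.map (Int.castRingHom (Localization.Away (t : ℤ))) γ) ∈ ψ.range :=
    fun γ hγ => ⟨PushoutI.of (φ := φ) true ⟨γ, hγ⟩, hψ_true ⟨γ, hγ⟩⟩
  refine ⟨fun g => Multiplicative.toAdd (Φ g), ?_, ?_, ?_⟩
  · intro g hg g' hg'
    have hgm := mem_of_apply_one_zero t ψ.range hS hS' htL g hg
    have hgm' := mem_of_apply_one_zero t ψ.range hS hS' htL g' hg'
    show Multiplicative.toAdd (Φ (g * g')) = Multiplicative.toAdd (Φ g) + Multiplicative.toAdd (Φ g')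
    rw [hmul g hgm g' hgm', toAdd_mul]
  · intro γ
    have := hof false γ
    rw [hψ_false] at this
    show Multiplicative.toAdd (Φ _) = _
    rw [this]
    rfl
  · intro γ
    have := hof true γ
    rw [hψ_true] at this
    show Multiplicative.toAdd (Φ _) = _
    rw [this]
    rfl

end Gamma0Away

end Literature.NumberTheory.EllipticCurves

end
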